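import Literature.Probability.RandomPlanarGeometry.SAWSubBallisticMaxDisplacement
import HarnessLib

/-!
# Eight-direction preliminaries: the diagonal tilt bound, the remaining lattice symmetries, and
# the covering of a Euclidean excursion by axis/diagonal projections

Topic `Literature/Probability/RandomPlanarGeometry` (continues `SAWTiltedFiniteMemory.lean` and
`SAWSubBallisticMaxDisplacement.lean`; consumed by `SAWSubBallisticEightDirections.lean`).

* `wprod_tiltD_eq` — `Π_i tiltD(w_i) = (ab)^{|w|} (a/b)^{x(w)+y(w)}`;
* **`card_sawWords_diag_ge_le`** — from `FiniteMemory.checkD`: `#{w ∈ sawWords n : x(w)+y(w) ≥ m} ≤ 2⁴¹ (N/(Dab))ⁿ (b/a)^m`;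
* **`card_maxEventDiag_le_of_checkD`** — with the first-passage decomposition (`card_maxEvent_le_sum`,
  readout `x+y`) and `c_j ≤ 2⁴¹·2.689ʲ` (`FiniteMemory.checkC_18`): the max-over-time diagonal event;
* `negY`, `negXY` and the transport data (`*_spec`) for `x ↦ -x`, `(x,y) ↦ (y,-x)`, `(x,y) ↦ (-y,x)`,
  `y ↦ -y`, `z ↦ -z` (additive, injective, realised by a relabelling of the step alphabet);
* **`exists_dir8_ge_of_euclidNorm_ge`** — `‖z‖₂ ≥ R ≥ 0 ⇒` some `±z_i ≥ 0.9238 R` or some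
  `±z₀ ± z₁ ≥ 1.3065 R` (rational constants just inside `cos(π/8) = 0.92388`, `√2 cos(π/8) = 1.30656`;
  the extremal point has `0.9238² + 0.3827² = 0.99987 < 1`).

## References

* H. Duminil-Copin, A. Hammond, *Self-avoiding walk is sub-ballistic*, Commun. Math. Phys. 324
  (2013) 401–423, Theorem 1.1 and §2.4 [DuminilCopinHammond2013].
* A. Pönitz, P. Tittmann, Electron. J. Combin. 7 (2000) R21, §3 [PonitzTittmann2000].
* N. Madras, G. Slade, *The Self-Avoiding Walk* (1993), §1.1 [MadrasSlade1993].
-/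

open Finset Literature.Probability.LatticeModels
open scoped BigOperators

namespace Literature.Probability.RandomPlanarGeometry.SAW

open FiniteMemory

/-! ### The diagonal tilt: `Π tiltD(w_i) = (ab)^{|w|} (a/b)^{x(w)+y(w)}` -/

/-- **`Π_i tiltD(w_i) = (ab)^{|w|} · (a/b)^{x(w) + y(w)}`** (as reals, `a, b > 0`), the endpoint
read through `wEnd`. [cite: DuminilCopinHammond2013, §2.4] -/
theorem wprod_tiltD_eq {a b : ℕ} (ha : 0 < a) (hb : 0 < b) (w : List Step) :
    (WordAutomaton.wprod (tiltD a b) w : ℝ) =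
      ((a : ℝ) * b) ^ w.length * ((a : ℝ) / b) ^ (wEnd w 0 + wEnd w 1) := by
  have ha' : (a : ℝ) ≠ 0 := by positivity
  have hb' : (b : ℝ) ≠ 0 := by positivity
  have hq : (a : ℝ) / b ≠ 0 := div_ne_zero ha' hb'
  induction w with
  | nil => simp
  | cons d w ih =>
    have hd : (tiltD a b d : ℝ) = (a : ℝ) * b * ((a : ℝ) / b) ^ (Step.dx d + Step.dy d) := by
      fin_cases d <;> simp [tiltD, wts, Step.dx, Step.dy] <;> field_simp
    rw [WordAutomaton.wprod_cons, Nat.cast_mul, ih, List.length_cons, pow_succ, wEnd_cons]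
    simp only [Pi.add_apply, Step.vec_apply_zero, Step.vec_apply_one]
    have hsplit : ((a : ℝ) / b) ^ (Step.dx d + wEnd w 0 + (Step.dy d + wEnd w 1)) =
        ((a : ℝ) / b) ^ (Step.dx d + Step.dy d) * ((a : ℝ) / b) ^ (wEnd w 0 + wEnd w 1) := by
      rw [← zpow_add₀ hq]; congr 1; ring
    rw [hsplit, hd]; ring

/-- The diagonal readout of the endpoint of a word: `x(w) + y(w) = (wEnd w) 0 + (wEnd w) 1`.
[cite: MadrasSlade1993, §1.1] -/
theorem diag_traj_length (w : List Step) : traj w w.length 0 + traj w w.length 1 = wEnd w 0 + wEnd w 1 := by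
  rw [traj_length]

/-- **Exponential tilting bound, diagonal readout**: from a successful diagonal check `checkD`
with `0 < b ≤ a`, for every `n` and integer level `m`,
`#{w ∈ sawWords n : x(w) + y(w) ≥ m} ≤ 2⁴¹ · (N/(D·a·b))ⁿ · (b/a)^m`. [cite: DuminilCopinHammond2013, §2.4] -/
theorem card_sawWords_diag_ge_le {K a b N D iters : ℕ} (h : checkD K a b N D iters = true)
    (hb : 0 < b) (hba : b ≤ a) (hD : 0 < D) (n : ℕ) (m : ℤ) :
    (((sawWords n).filter fun w => m ≤ traj w w.length 0 + traj w w.length 1).card : ℝ) ≤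
      2 ^ 41 * ((N : ℝ) / (D * a * b)) ^ n * ((b : ℝ) / a) ^ m := by
  have ha : 0 < a := lt_of_lt_of_le hb hba
  have hab0 : (0 : ℝ) < (a : ℝ) * b := by positivity
  have hr1 : (1 : ℝ) ≤ (a : ℝ) / b := by
    rw [le_div_iff₀ (by exact_mod_cast hb), one_mul]; exact_mod_cast hba
  have hr0 : (0 : ℝ) < (a : ℝ) / b := by positivity
  set F := (sawWords n).filter fun w => m ≤ traj w w.length 0 + traj w w.length 1 with hF
  have hlow : (F.card : ℝ) * (((a : ℝ) * b) ^ n * ((a : ℝ) / b) ^ m) ≤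
      ∑ w ∈ sawWords n, (WordAutomaton.wprod (tiltD a b) w : ℝ) := by
    calc (F.card : ℝ) * (((a : ℝ) * b) ^ n * ((a : ℝ) / b) ^ m)
        = ∑ w ∈ F, ((a : ℝ) * b) ^ n * ((a : ℝ) / b) ^ m := by rw [sum_const, nsmul_eq_mul]
      _ ≤ ∑ w ∈ F, (WordAutomaton.wprod (tiltD a b) w : ℝ) := by
          refine sum_le_sum fun w hw => ?_
          rw [hF, mem_filter, mem_sawWords, diag_traj_length] at hw
          rw [wprod_tiltD_eq ha hb, hw.1.1]
          exact mul_le_mul_of_nonneg_left (zpow_le_zpow_right₀ hr1 hw.2) (pow_nonneg hab0.le _)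
      _ ≤ ∑ w ∈ sawWords n, (WordAutomaton.wprod (tiltD a b) w : ℝ) :=
          sum_le_sum_of_subset_of_nonneg (filter_subset _ _) fun _ _ _ => Nat.cast_nonneg _
  have hup : (∑ w ∈ sawWords n, (WordAutomaton.wprod (tiltD a b) w : ℝ)) * (D : ℝ) ^ n ≤
      (N : ℝ) ^ n * 2 ^ 41 := by
    have := sum_sawWords_wts_mul_pow_le_of_checkT (w0 := a * a) (w1 := a * a) (w2 := b * b)
      (w3 := b * b) h n
    exact_mod_cast this
  have hDn : (0 : ℝ) < (D : ℝ) ^ n := by positivity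
  have hpos : (0 : ℝ) < ((a : ℝ) * b) ^ n * ((a : ℝ) / b) ^ m := mul_pos (pow_pos hab0 _) (zpow_pos hr0 _)
  have key : (F.card : ℝ) * (((a : ℝ) * b) ^ n * ((a : ℝ) / b) ^ m) * (D : ℝ) ^ n ≤ (N : ℝ) ^ n * 2 ^ 41 :=
    le_trans (mul_le_mul_of_nonneg_right hlow hDn.le) hup
  have hrew : 2 ^ 41 * ((N : ℝ) / (D * a * b)) ^ n * ((b : ℝ) / a) ^ m =
      (N : ℝ) ^ n * 2 ^ 41 / ((((a : ℝ) * b) ^ n * ((a : ℝ) / b) ^ m) * (D : ℝ) ^ n) := by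
    rw [div_pow, show ((b : ℝ) / a) = ((a : ℝ) / b)⁻¹ by rw [inv_div], inv_zpow]
    field_simp
    ring
  rw [hrew, le_div_iff₀ (mul_pos hpos hDn), ← mul_assoc]
  exact key

/-- **Max-over-time bound along the diagonal `x + y`** from a diagonal certificate
(`0 < b < a`, `N/(Dab) ≥ 2.689`): `#{w ∈ sawWords n : ∃ k ≤ n, x(traj w k) + y(traj w k) ≥ m} ≤
(n+1) · 2⁸² · (N/(Dab))ⁿ · (b/a)^m`. [cite: DuminilCopinHammond2013, Thm 1.1] -/
theorem card_maxEventDiag_le_of_checkD {K a b N D iters : ℕ} (h : checkD K a b N D iters = true)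
    (hb : 0 < b) (hba : b < a) (hD : 0 < D) (hbig : (2689 / 1000 : ℝ) ≤ (N : ℝ) / (D * a * b))
    (n : ℕ) (m : ℤ) :
    (((sawWords n).filter fun w => ∃ k ≤ n, m ≤ traj w k 0 + traj w k 1).card : ℝ) ≤
      (n + 1) * 2 ^ 82 * ((N : ℝ) / (D * a * b)) ^ n * ((b : ℝ) / a) ^ m := by
  have ha : 0 < a := lt_trans hb hba
  have hl0 : (0 : ℝ) ≤ (N : ℝ) / (D * a * b) := by positivity
  set lam : ℝ := (N : ℝ) / (D * a * b) with hlam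
  have hc : ∀ j : ℕ, ((sawWords j).card : ℝ) ≤ 2 ^ 41 * lam ^ j := by
    intro j
    have h1 := count_mul_pow_le_of_checkC checkC_18 j
    rw [← count_eq_card_sawWords]
    have h2 : (count j : ℝ) * (1000 : ℝ) ^ j ≤ (2689 : ℝ) ^ j * 2 ^ 41 := by exact_mod_cast h1
    have h3 : (count j : ℝ) ≤ 2 ^ 41 * (2689 / 1000 : ℝ) ^ j := by
      rw [div_pow, mul_div_assoc', le_div_iff₀ (by positivity)]; linarith
    exact le_trans h3 (by gcongr)
  have hA : ∀ k : ℕ, ((((sawWords k).filter fun u => m ≤ traj u u.length 0 + traj u u.length 1).card : ℝ)) ≤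
      2 ^ 41 * lam ^ k * ((b : ℝ) / a) ^ m := fun k => card_sawWords_diag_ge_le h hb hba.le hD k m
  have hfp := card_maxEvent_le_sum (fun z => z 0 + z 1) n m
  calc (((sawWords n).filter fun w => ∃ k ≤ n, m ≤ traj w k 0 + traj w k 1).card : ℝ)
      ≤ ∑ k ∈ range (n + 1), ((((sawWords k).filter fun u => m ≤ traj u u.length 0 + traj u u.length 1).card : ℝ)) *
          ((sawWords (n - k)).card : ℝ) := by exact_mod_cast hfp
    _ ≤ ∑ k ∈ range (n + 1), (2 ^ 41 * lam ^ k * ((b : ℝ) / a) ^ m) * (2 ^ 41 * lam ^ (n - k)) :=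
        sum_le_sum fun k _ => mul_le_mul (hA k) (hc (n - k)) (Nat.cast_nonneg _) (by positivity)
    _ = ∑ k ∈ range (n + 1), 2 ^ 82 * lam ^ n * ((b : ℝ) / a) ^ m := by
        refine sum_congr rfl fun k hk => ?_
        rw [mem_range] at hk
        have : lam ^ k * lam ^ (n - k) = lam ^ n := by rw [← pow_add]; congr 1; omega
        calc 2 ^ 41 * lam ^ k * ((b : ℝ) / a) ^ m * (2 ^ 41 * lam ^ (n - k))
            = 2 ^ 41 * 2 ^ 41 * (lam ^ k * lam ^ (n - k)) * ((b : ℝ) / a) ^ m := by ring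
          _ = _ := by rw [this]; norm_num
    _ = (n + 1) * 2 ^ 82 * lam ^ n * ((b : ℝ) / a) ^ m := by
        rw [sum_const, card_range, nsmul_eq_mul]; push_cast; ring

/-! ### Two more lattice symmetries: `y ↦ -y` and `z ↦ -z` -/

/-- The reflection `y ↦ -y` (`d ↦ -d` on steps). [cite: MadrasSlade1993, §1.1] -/
def negY (z : Site 2) : Site 2 := ![z 0, -z 1]

/-- The half-turn `z ↦ -z` (`d ↦ d + 2` on steps). [cite: MadrasSlade1993, §1.1] -/
def negXY (z : Site 2) : Site 2 := ![-z 0, -z 1]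

/-- `negY` is additive, injective and realises `d ↦ -d` on steps. [cite: MadrasSlade1993, §1.1] -/
theorem negY_spec : negY 0 = 0 ∧ (∀ x y, negY (x + y) = negY x + negY y) ∧
    (∀ d, Step.vec (FiniteMemory.refl 0 d) = negY (Step.vec d)) ∧ Function.Injective negY := by
  refine ⟨?_, fun x y => ?_, fun d => ?_, fun x y h => ?_⟩
  · ext i; fin_cases i
    · rfl
    · show -((0 : Site 2) 1) = 0; simp
  · ext i; fin_cases i
    · rfl
    · show -((x + y) 1) = -(x 1) + -(y 1); simp only [Pi.add_apply]; ring
  · fin_cases d <;> decide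
  · have h0 := congrFun h 0; have h1 := congrFun h 1
    simp only [negY, Matrix.cons_val_zero, Matrix.cons_val_one, neg_inj] at h0 h1
    ext i; fin_cases i; exacts [h0, h1]

/-- `negXY` is additive, injective and realises `d ↦ d + 2` on steps. [cite: MadrasSlade1993, §1.1] -/
theorem negXY_spec : negXY 0 = 0 ∧ (∀ x y, negXY (x + y) = negXY x + negXY y) ∧
    (∀ d, Step.vec (FiniteMemory.rot 2 d) = negXY (Step.vec d)) ∧ Function.Injective negXY := by
  refine ⟨?_, fun x y => ?_, fun d => ?_, fun x y h => ?_⟩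
  · ext i; fin_cases i
    · show -((0 : Site 2) 0) = 0; simp
    · show -((0 : Site 2) 1) = 0; simp
  · ext i; fin_cases i
    · show -((x + y) 0) = -(x 0) + -(y 0); simp only [Pi.add_apply]; ring
    · show -((x + y) 1) = -(x 1) + -(y 1); simp only [Pi.add_apply]; ring
  · fin_cases d <;> decide
  · have h0 := congrFun h 0; have h1 := congrFun h 1
    simp only [negXY, Matrix.cons_val_zero, Matrix.cons_val_one, neg_inj] at h0 h1
    ext i; fin_cases i; exacts [h0, h1]

/-- `negX` is additive, injective and realises `d ↦ 2 - d` on steps (restated here; the copy in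
`SAWSubBallisticMaxDisplacement` is private). [cite: MadrasSlade1993, §1.1] -/
theorem negX_spec' : negX 0 = 0 ∧ (∀ x y, negX (x + y) = negX x + negX y) ∧
    (∀ d, Step.vec (FiniteMemory.refl 2 d) = negX (Step.vec d)) ∧ Function.Injective negX := by
  refine ⟨?_, fun x y => ?_, fun d => ?_, fun x y h => ?_⟩
  · ext i; fin_cases i
    · show -((0 : Site 2) 0) = 0; simp
    · rfl
  · ext i; fin_cases i
    · show -((x + y) 0) = -(x 0) + -(y 0); simp only [Pi.add_apply]; ring
    · rfl
  · fin_cases d <;> decide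
  · have h0 := congrFun h 0; have h1 := congrFun h 1
    simp only [negX, Matrix.cons_val_zero, Matrix.cons_val_one, neg_inj] at h0 h1
    ext i; fin_cases i; exacts [h0, h1]

/-- `rotYX` is additive, injective and realises `d ↦ d + 3` on steps (restated; the copy in
`SAWSubBallisticMaxDisplacement` is private). [cite: MadrasSlade1993, §1.1] -/
theorem rotYX_spec' : rotYX 0 = 0 ∧ (∀ x y, rotYX (x + y) = rotYX x + rotYX y) ∧
    (∀ d, Step.vec (FiniteMemory.rot 3 d) = rotYX (Step.vec d)) ∧ Function.Injective rotYX := by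
  refine ⟨?_, fun x y => ?_, fun d => ?_, fun x y h => ?_⟩
  · ext i; fin_cases i
    · rfl
    · show -((0 : Site 2) 0) = 0; simp
  · ext i; fin_cases i
    · rfl
    · show -((x + y) 0) = -(x 0) + -(y 0); simp only [Pi.add_apply]; ring
  · fin_cases d <;> decide
  · have h0 := congrFun h 0; have h1 := congrFun h 1
    simp only [rotYX, Matrix.cons_val_zero, Matrix.cons_val_one, neg_inj] at h0 h1
    ext i; fin_cases i; exacts [h1, h0]

/-- `rotNegYX` is additive, injective and realises `d ↦ d + 1` on steps (restated). [cite: MadrasSlade1993, §1.1] -/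
theorem rotNegYX_spec' : rotNegYX 0 = 0 ∧ (∀ x y, rotNegYX (x + y) = rotNegYX x + rotNegYX y) ∧
    (∀ d, Step.vec (FiniteMemory.rot 1 d) = rotNegYX (Step.vec d)) ∧ Function.Injective rotNegYX := by
  refine ⟨?_, fun x y => ?_, fun d => ?_, fun x y h => ?_⟩
  · ext i; fin_cases i
    · show -((0 : Site 2) 1) = 0; simp
    · rfl
  · ext i; fin_cases i
    · show -((x + y) 1) = -(x 1) + -(y 1); simp only [Pi.add_apply]; ring
    · rfl
  · fin_cases d <;> decide
  · have h0 := congrFun h 0; have h1 := congrFun h 1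
    simp only [rotNegYX, Matrix.cons_val_zero, Matrix.cons_val_one, neg_inj] at h0 h1
    ext i; fin_cases i; exacts [h1, h0]

/-- Reflections of the step alphabet are injective. [cite: PonitzTittmann2000, §3] -/
theorem refl_injective' (r : Fin 4) : Function.Injective (FiniteMemory.refl r) :=
  fun a b h => by simp only [FiniteMemory.refl_apply] at h; exact sub_right_injective h

/-- Rotations of the step alphabet are injective. [cite: PonitzTittmann2000, §3] -/
theorem rot_injective' (r : Fin 4) : Function.Injective (FiniteMemory.rot r) :=
  fun a b h => by simp only [FiniteMemory.rot_apply] at h; exact add_left_cancel h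

/-! ### Eight directions: a Euclidean excursion has a large axis OR diagonal projection -/

/-- **Eight-direction covering with rational constants**: if `‖z‖₂ ≥ R ≥ 0` then one of `±z₀, ±z₁`
is `≥ 0.9238 R` or one of `±z₀ ± z₁` is `≥ 1.3065 R` (`cos(π/8) = 0.92388…`, `√2 cos(π/8) = 1.30656…`).
[cite: DuminilCopinHammond2013, §1.1] -/
theorem exists_dir8_ge_of_euclidNorm_ge {R : ℝ} (hR : 0 ≤ R) {z : Site 2} (h : R ≤ Zd.euclidNorm z) :
    (9238 / 10000 * R ≤ (z 0 : ℝ) ∨ 9238 / 10000 * R ≤ -(z 0 : ℝ) ∨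
      9238 / 10000 * R ≤ (z 1 : ℝ) ∨ 9238 / 10000 * R ≤ -(z 1 : ℝ)) ∨
    (13065 / 10000 * R ≤ (z 0 : ℝ) + z 1 ∨ 13065 / 10000 * R ≤ -((z 0 : ℝ) + z 1) ∨
      13065 / 10000 * R ≤ (z 0 : ℝ) - z 1 ∨ 13065 / 10000 * R ≤ -((z 0 : ℝ) - z 1)) := by
  have hsq : R ^ 2 ≤ ((z 0 : ℝ)) ^ 2 + ((z 1 : ℝ)) ^ 2 := by
    have := pow_le_pow_left₀ hR h 2
    rw [Zd.sq_euclidNorm, Fin.sum_univ_two] at this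
    exact this
  set x : ℝ := (z 0 : ℝ) with hx
  set y : ℝ := (z 1 : ℝ) with hy
  by_contra hcon
  simp only [not_or, not_le] at hcon
  obtain ⟨⟨h1, h2, h3, h4⟩, h5, h6, h7, h8⟩ := hcon
  -- `|x|, |y| < 0.9238 R` and `|x| + |y| < 1.3065 R` force `x² + y² < R²`
  have hax : |x| < 9238 / 10000 * R := abs_lt.2 ⟨by linarith, h1⟩
  have hay : |y| < 9238 / 10000 * R := abs_lt.2 ⟨by linarith, h3⟩
  have hsum : |x| + |y| < 13065 / 10000 * R := by
    rcases le_or_gt 0 x with hx0 | hx0 <;> rcases le_or_gt 0 y with hy0 | hy0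
    · rw [abs_of_nonneg hx0, abs_of_nonneg hy0]; linarith
    · rw [abs_of_nonneg hx0, abs_of_neg hy0]; linarith
    · rw [abs_of_neg hx0, abs_of_nonneg hy0]; linarith
    · rw [abs_of_neg hx0, abs_of_neg hy0]; linarith
  have hx2 : x ^ 2 = |x| ^ 2 := (sq_abs x).symm
  have hy2 : y ^ 2 = |y| ^ 2 := (sq_abs y).symm
  have ha0 : 0 ≤ |x| := abs_nonneg x
  have hb0 : 0 ≤ |y| := abs_nonneg y
  -- WLOG-free: treat the two orderings of `|x|, |y|`
  have key : ∀ a b : ℝ, 0 ≤ b → b ≤ a → a < 9238 / 10000 * R → a + b < 13065 / 10000 * R →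
      a ^ 2 + b ^ 2 < R ^ 2 ∨ R = 0 := by
    intro a b hb0 hba haR habR
    rcases eq_or_lt_of_le hR with hR0 | hRpos
    · exact Or.inr hR0.symm
    left
    rcases le_or_gt a (13065 / 20000 * R) with hsmall | hlarge
    · nlinarith
    · have hb' : b < 13065 / 10000 * R - a := by linarith
      have hb'' : b ^ 2 ≤ (13065 / 10000 * R - a) ^ 2 := by
        apply pow_le_pow_left₀ hb0; linarith
      nlinarith [mul_pos hRpos hRpos]
  rcases le_total (|y|) (|x|) with hyx | hxy
  · rcases key |x| |y| hb0 hyx hax hsum with hlt | hR0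
    · rw [← hx2, ← hy2] at hlt; linarith
    · subst hR0
      simp only [mul_zero] at h1 h2
      linarith
  · rcases key |y| |x| ha0 hxy hay (by linarith) with hlt | hR0
    · rw [← hx2, ← hy2] at hlt; linarith
    · subst hR0
      simp only [mul_zero] at h1 h2
      linarith

end Literature.Probability.RandomPlanarGeometry.SAW
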